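import Summits.AtomisticToContinuum.Crystallization.Theorems.PalmUnimodularRigidityLayeredLawsSelectHcpCertificateDefsC
import Mathlib.Probability.Kernel.MeasurableIntegral
import Mathlib.Probability.Kernel.Composition.MapComap
import Literature.Probability.Process.PointStationaryTransfer

/-!
# Route `PalmUnimodularRigidity`, crux `LayeredLawsSelectHcp` (stmt-AtomisticToContinuum-9226),
# line `mtp-prestress-split-ergodic-frame`: joint measurability of the iterated Campbell integral

The measurable surrogate of a chart sum, `iterInt κ L (chartWeight e ψ y) μ z` (the iterated Bochner integral of the chart weight
along the label list `L` against the s-finite kernel `κ` evaluated at `μ`), is jointly measurable in `((μ, y), z)`: the base case is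
the chart weight itself, a measurable function on a measurable set (the local chart patterns are a finite Boolean combination of
coordinate conditions), and the cons step `∫ x, iterInt κ L H μ (update z u x) ∂(κ μ)` is a kernel integral of a jointly measurable
integrand (`MeasureTheory.StronglyMeasurable.integral_kernel_prod_right'` for the s-finite kernel `κ.comap (q ↦ q.1.1)`).
Composing with the jointly measurable re-rooting `(μ, y) ↦ θ_y (κ μ) = (κ μ).map (· - y)`
(`Literature.Probability.Process.measurable_map_sub_kernel`) gives the transport surrogate
`(μ, y) ↦ iterInt κ L (chartWeight e ψ y) (θ_y (κ μ)) 0` (`tube_measurable_iterInt`); on locally finite `μ` (where `κ μ = μ`,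
`Literature.Probability.Process.exists_isSFiniteKernel_apply_eq_self`) this is the iterated integral against the re-rooted
configuration `θ_y μ` itself, so the sent / received masses of the surrogate are unchanged on the almost sure event.

Why the kernel sits INSIDE the re-rooting.  The re-rooting of `μ` itself, `(μ, y) ↦ θ_y μ = μ.map (· - y)`, is not measurable on
all of `Measure E × E` (Giry ⊗ Borel): for `μ = Σ_{a ∈ A} δ_a` with `A ⊂ E` non-Borel, the section `y ↦ (θ_y μ) {0} = μ {y} = 1_A y`
is not measurable.  Consequently the variant with `θ_y μ` in place of `θ_y (κ μ)` is false for some finite kernel: with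
`κ μ' = 1[μ' {0} ≠ 0 ∧ μ' D ≤ 56] • μ'|_D`, `D = {1/2 ≤ ‖z‖ ≤ 3}`, `ψ ≡ 1`, `e` a strut label, `L` the `56` non-root near-ball
labels and `μ = Σ_{u ∈ L} δ_{hcpSite u - hcpSite e} + Σ_{a ∈ A} δ_a`, `A ⊂ B(-hcpSite e, 1/100)` non-Borel, the section
`y ↦ iterInt κ L (chartWeight e ψ y) (θ_y μ) 0` equals `c(y) · 1_A y` with `c ≥ 1` on that ball (the identity assignment
`u ↦ hcpSite u - hcpSite e - y` is a local chart pattern with label `e` at `-y`). [folklore]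
-/

noncomputable section

namespace Summit.AtomisticToContinuum.Crystallization.Theorems.PalmUnimodularRigidity.LayeredLawsSelectHcp

open MeasureTheory Set ProbabilityTheory

/-- The local chart patterns form a measurable set: `IsLocalChartPattern` is a finite Boolean combination, over the countable label
type, of closed / open conditions on pairs of coordinates. [folklore] -/
theorem measurable_isLocalChartPattern :
    Measurable fun z : ℤ × ℤ × ℤ → EuclideanSpace ℝ (Fin 3) => IsLocalChartPattern z := by
  unfold IsLocalChartPattern Set.InjOn
  refine Measurable.and ((measurable_pi_apply 0).eq_const 0) (Measurable.and ?_ ?_)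
  · refine Measurable.forall fun u => Measurable.imp measurable_const ?_
    refine Measurable.forall fun w => Measurable.imp measurable_const ?_
    exact Measurable.imp ((measurable_pi_apply u).eq (measurable_pi_apply w)) measurable_const
  · refine Measurable.forall fun u => Measurable.imp measurable_const ?_
    refine Measurable.forall fun w => Measurable.imp measurable_const ?_
    have hd : Measurable fun z : ℤ × ℤ × ℤ → EuclideanSpace ℝ (Fin 3) => dist (z u) (z w) :=
      (measurable_pi_apply u).dist (measurable_pi_apply w)
    exact Measurable.iff measurable_const ((Measurable.lt measurable_const hd).and (hd.le' measurable_const))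

/-- The chart weight is jointly measurable in the base point `y` and the labelled configuration `z`. [folklore] -/
theorem measurable_chartWeight (e : ℤ × ℤ × ℤ) (ψ : (↥nearBall → EuclideanSpace ℝ (Fin 3)) → ℝ) (hψ : Measurable ψ) :
    Measurable fun q : EuclideanSpace ℝ (Fin 3) × (ℤ × ℤ × ℤ → EuclideanSpace ℝ (Fin 3)) => chartWeight e ψ q.1 q.2 := by
  unfold chartWeight
  refine Measurable.ite ?_ (hψ.comp (measurable_pi_lambda _ fun u => (measurable_pi_apply (u : ℤ × ℤ × ℤ)).comp measurable_snd))
    measurable_const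
  exact measurableSet_setOf.2 ((measurable_isLocalChartPattern.comp measurable_snd).and
    (((measurable_pi_apply e).comp measurable_snd).eq measurable_fst.neg))

/-- **Joint measurability of the iterated integral** in the kernel argument, the base point and the labelled configuration:
`((μ, y), z) ↦ iterInt κ L (chartWeight e ψ y) μ z` is measurable for every label list `L` (induction on `L`; the cons step is a
kernel integral of a jointly measurable integrand against the s-finite kernel `κ.comap (q ↦ q.1.1)`). [folklore] -/
theorem measurable_iterInt_chartWeight (κ : Kernel (Measure (EuclideanSpace ℝ (Fin 3))) (EuclideanSpace ℝ (Fin 3)))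
    [IsSFiniteKernel κ] (e : ℤ × ℤ × ℤ) (ψ : (↥nearBall → EuclideanSpace ℝ (Fin 3)) → ℝ) (hψ : Measurable ψ)
    (L : List (ℤ × ℤ × ℤ)) :
    Measurable fun q : (Measure (EuclideanSpace ℝ (Fin 3)) × EuclideanSpace ℝ (Fin 3)) ×
        (ℤ × ℤ × ℤ → EuclideanSpace ℝ (Fin 3)) => iterInt κ L (chartWeight e ψ q.1.2) q.1.1 q.2 := by
  induction L with
  | nil =>
    exact (measurable_chartWeight e ψ hψ).comp (measurable_fst.snd.prodMk measurable_snd)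
  | cons u L ih =>
    have hg : Measurable fun qx : ((Measure (EuclideanSpace ℝ (Fin 3)) × EuclideanSpace ℝ (Fin 3)) ×
        (ℤ × ℤ × ℤ → EuclideanSpace ℝ (Fin 3))) × EuclideanSpace ℝ (Fin 3) => (qx.1.1, Function.update qx.1.2 u qx.2) :=
      measurable_fst.fst.prodMk (measurable_update'.comp (measurable_fst.snd.prodMk measurable_snd))
    have hF : StronglyMeasurable fun qx : ((Measure (EuclideanSpace ℝ (Fin 3)) × EuclideanSpace ℝ (Fin 3)) ×
        (ℤ × ℤ × ℤ → EuclideanSpace ℝ (Fin 3))) × EuclideanSpace ℝ (Fin 3) =>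
        iterInt κ L (chartWeight e ψ qx.1.1.2) qx.1.1.1 (Function.update qx.1.2 u qx.2) :=
      (ih.comp hg).stronglyMeasurable
    have hI := hF.integral_kernel_prod_right'
      (κ := κ.comap (fun q : (Measure (EuclideanSpace ℝ (Fin 3)) × EuclideanSpace ℝ (Fin 3)) ×
        (ℤ × ℤ × ℤ → EuclideanSpace ℝ (Fin 3)) => q.1.1) measurable_fst.fst)
    exact hI.measurable

/-- Joint measurability of `(μ, y) ↦ iterInt κ L (chartWeight e ψ y) μ 0` on `Measure E × E` (the iterated integral is taken
against `κ μ`). [folklore] -/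
theorem measurable_iterInt_chartWeight_zero :
    ∀ (κ : ProbabilityTheory.Kernel (MeasureTheory.Measure (EuclideanSpace ℝ (Fin 3))) (EuclideanSpace ℝ (Fin 3))),
      ProbabilityTheory.IsSFiniteKernel κ → ∀ (e : ℤ × ℤ × ℤ) (ψ : (↥nearBall → EuclideanSpace ℝ (Fin 3)) → ℝ),
      Measurable ψ → ∀ L : List (ℤ × ℤ × ℤ),
        Measurable (fun p : MeasureTheory.Measure (EuclideanSpace ℝ (Fin 3)) × EuclideanSpace ℝ (Fin 3) =>
          iterInt κ L (chartWeight e ψ p.2) p.1 0) := by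
  intro κ hκ e ψ hψ L
  exact (measurable_iterInt_chartWeight κ e ψ hψ L).comp
    (measurable_id.prodMk (measurable_const (a := (0 : ℤ × ℤ × ℤ → EuclideanSpace ℝ (Fin 3)))))

/-- **The transport surrogate is jointly measurable**: `(μ, y) ↦ iterInt κ L (chartWeight e ψ y) (θ_y (κ μ)) 0`, the iterated
Campbell integral of the chart weight against the RE-ROOTED kernel configuration `θ_y (κ μ) = (κ μ).map (· - y)`, is measurable on
`Measure E × E` (on locally finite `μ`, where `κ μ = μ`, this is the iterated integral against `θ_y μ`). [folklore] -/
theorem tube_measurable_iterIntK :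
    ∀ (κ : ProbabilityTheory.Kernel (MeasureTheory.Measure (EuclideanSpace ℝ (Fin 3))) (EuclideanSpace ℝ (Fin 3))),
      ProbabilityTheory.IsSFiniteKernel κ → ∀ (e : ℤ × ℤ × ℤ) (ψ : (↥nearBall → EuclideanSpace ℝ (Fin 3)) → ℝ),
      Measurable ψ → ∀ L : List (ℤ × ℤ × ℤ),
        Measurable (fun p : MeasureTheory.Measure (EuclideanSpace ℝ (Fin 3)) × EuclideanSpace ℝ (Fin 3) =>
          iterInt κ L (chartWeight e ψ p.2) (MeasureTheory.Measure.map (fun z => z - p.2) (κ p.1)) 0) := by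
  intro κ hκ e ψ hψ L
  exact (measurable_iterInt_chartWeight_zero κ hκ e ψ hψ L).comp
    ((Literature.Probability.Process.measurable_map_sub_kernel κ).prodMk measurable_snd)

end Summit.AtomisticToContinuum.Crystallization.Theorems.PalmUnimodularRigidity.LayeredLawsSelectHcp

end
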